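import Summits.ValiantsHypothesis.ValiantsHypothesis.Theses.DivisionGap
import Summits.ValiantsHypothesis.ValiantsHypothesis.Theorems.PerDivisionHard.Negative.LoadBearing
import Literature.Computability.AlgebraicComplexity.StandardFamiliesProofs

/-!
# `DivisionGap.PerCofactorDegreeReduction` (stmt-ValiantsHypothesis-15046): what a kill must
# exhibit, and the two load-bearing `≠ 0` — negative knowledge from the standing disprover

The crux reads `∃ k, ∀ n, ∀ h ≠ 0, ∃ h' ≠ 0, deg h' ≤ B ∧ L⁺(per_n · h') ≤ B` with
`B = 2 ^ ((log₂ n + log₂ L⁺(per_n · h) + k) ^ k)` and `L⁺ = complexity` over `ℝ≥0`.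

* `two_pow_lt_complexity_perPoly_of_not_pcdr` — **the price of a kill.**  Testing the witness
  `h' = 1` shows: `¬ crux` forces, for EVERY `k`, an `n` and a nonzero monotone multiple `per_n · h`
  with `2 ^ ((log₂ n + log₂ L⁺(per_n · h) + k) ^ k) < L⁺(per_n) ≤ (n+1)!`, i.e. a monotone circuit of
  size `2^{O((n log n)^{1/k})}` — SUB-EXPONENTIAL in every root of `n` — for a nonzero multiple of the
  permanent, and (`…_io`) this happens for arbitrarily large `n`.  No multiple of `per_n` with a
  monotone circuit of size `2^{o(n)}` is known (Jerrum–Snir 1982: `L⁺(per_n) = n(2^{n-1}-1)`;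
  Hrubeš–Yehudayoff 2021 §6 Problem 2); after complexification such a multiple bounds the EXCLUSION
  complexity of `per_n` over `ℂ`, hence (Bürgisser 2004 Thm 1.3, see
  `Cruxes/PerMultiplesHard/Disproof.lean §Exclusion`) its border complexity: a kill puts `per_n` in
  border size `2^{n^{o(1)}}` infinitely often.  Compare `PerMultiplesHard`, whose kill needs only a
  QUASI-POLYNOMIAL multiple: this crux is the more exposed statement, but the exposure is still an
  exponential-hardness question about the permanent, not a small-model question.
* `two_pow_lt_complexity_perPoly_of_not_creationDegree`, `…_of_not_cheapPositivization` — the same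
  price for the two OPEN stubs K1/K2 of the picked line `Sketch` (testing `A = per_n`, `p = per_n`):
  any kill exhibits a nonzero NONNEGATIVE element of the ideal `(per_n) ⊂ ℝ[x]` of monotone complexity
  below `2^{(log₂ L⁺(per_n))^{1/k}}`.
* `pcdr_iff_uniform_witness` — the witness `h'` may be chosen depending on `n` only (the bound is
  monotone in `s = L⁺(per_n · h)`, which attains its minimum `E_n`): the crux is a statement about the
  single function `n ↦ (E_n, cheapest low-degree multiple)`.
* `pcdr_without_witness_nonzero` — with `h' ≠ 0` deleted the crux is TRIVIAL (`h' = 0`): the witness'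
  non-vanishing is what carries content.
* `not_perMultiplesHard_of_pcdr_without_nonzero` — with `h ≠ 0` deleted (so `h = 0`, `s = L⁺(0) = 0`
  is allowed) the crux says "per_n has nonzero multiples of quasi-polynomial degree AND monotone cost",
  which refutes the sibling crux `PerMultiplesHard`; so `h ≠ 0` is load-bearing modulo H1.

All statements are inline (no new named facts).
-/

noncomputable section

namespace Summit.ValiantsHypothesis.Theorems.PerCofactorDegreeReductionNegative

open Literature.Computability.AlgebraicComplexity MvPolynomial
open Summit.ValiantsHypothesis.ValiantsHypothesis.Theses.DivisionGap
  (PerCofactorDegreeReduction PerMultiplesHard)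
open Summit.ValiantsHypothesis.Theorems.PerDivisionHardNegative
open scoped NNReal

/-! ### Arithmetic of the quasi-polynomial bound -/

/-- `n < 2 ^ ((log₂ n + a + k) ^ k)` for `k ≥ 1`. [folklore] -/
theorem lt_two_pow_qp (n a k : ℕ) (hk : 1 ≤ k) : n < 2 ^ ((Nat.log 2 n + a + k) ^ k) := by
  have h1 : n < 2 ^ (Nat.log 2 n + 1) := Nat.lt_pow_succ_log_self (by norm_num) n
  have h2 : Nat.log 2 n + 1 ≤ (Nat.log 2 n + a + k) ^ k :=
    (by omega : Nat.log 2 n + 1 ≤ Nat.log 2 n + a + k).trans (Nat.le_self_pow (by omega) _)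
  exact h1.trans_le (Nat.pow_le_pow_right (by norm_num) h2)

/-- Monotonicity of the bound in `k`. [folklore] -/
theorem qp_mono {a k k' : ℕ} (hkk : k ≤ k') (hk' : 1 ≤ k') : (a + k) ^ k ≤ (a + k') ^ k' :=
  (Nat.pow_le_pow_left (by omega) k).trans (Nat.pow_le_pow_right (by omega) hkk)

/-- `L⁺(per_n) ≤ (n+1)!`. [folklore] -/
theorem complexity_perPoly_le_factorial_succ (n : ℕ) :
    complexity (perPoly (Fin n) ℝ≥0) ≤ (n + 1).factorial := by
  rw [Nat.factorial_succ]
  exact complexity_perPoly_le_factorial n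

/-! ### The price of a kill of the crux -/

/-- **A kill of the crux exhibits a sub-exponential monotone multiple of the permanent.**  If
`PerCofactorDegreeReduction` fails then for every `k` some nonzero `h` has
`2 ^ ((log₂ n + log₂ L⁺(per_n · h) + k) ^ k) < L⁺(per_n)` (the witness `h' = 1` must fail), i.e.
`L⁺(per_n · h) < 2^{(log₂ L⁺(per_n))^{1/k}}`. [folklore] -/
theorem two_pow_lt_complexity_perPoly_of_not_pcdr (hneg : ¬ PerCofactorDegreeReduction) (k : ℕ) :
    ∃ n, ∃ h : MvPolynomial (Fin n × Fin n) ℝ≥0, h ≠ 0 ∧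
      2 ^ ((Nat.log 2 n + Nat.log 2 (complexity (perPoly (Fin n) ℝ≥0 * h)) + k) ^ k) <
        complexity (perPoly (Fin n) ℝ≥0) := by
  by_contra hcon
  push Not at hcon
  apply hneg
  refine ⟨k, fun n h hh => ⟨1, one_ne_zero, by simp, ?_⟩⟩
  rw [mul_one]
  exact hcon n h hh

/-- … with the factorial ceiling made explicit: `2 ^ ((log₂ n + log₂ s + k) ^ k) < (n+1)!`,
`s = L⁺(per_n · h)`; so `(log₂ n + log₂ s + k)^k < log₂ (n+1)! ≤ n log₂ (n+1)`. [folklore] -/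
theorem two_pow_lt_factorial_of_not_pcdr (hneg : ¬ PerCofactorDegreeReduction) (k : ℕ) :
    ∃ n, ∃ h : MvPolynomial (Fin n × Fin n) ℝ≥0, h ≠ 0 ∧
      2 ^ ((Nat.log 2 n + Nat.log 2 (complexity (perPoly (Fin n) ℝ≥0 * h)) + k) ^ k) <
        (n + 1).factorial := by
  obtain ⟨n, h, hh, hlt⟩ := two_pow_lt_complexity_perPoly_of_not_pcdr hneg k
  exact ⟨n, h, hh, hlt.trans_le (complexity_perPoly_le_factorial_succ n)⟩

/-- **… for arbitrarily large `n`** (raise `k` past `n₀!` and use `L⁺(per_m) ≤ (m+1)!`): a kill gives,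
for every `k` and beyond every `n₀`, a nonzero multiple `per_n · h` of monotone complexity `s` with
`2 ^ ((log₂ n + log₂ s + k) ^ k) < L⁺(per_n)`. [folklore] -/
theorem two_pow_lt_complexity_perPoly_io_of_not_pcdr (hneg : ¬ PerCofactorDegreeReduction)
    (k n₀ : ℕ) :
    ∃ n ≥ n₀, ∃ h : MvPolynomial (Fin n × Fin n) ℝ≥0, h ≠ 0 ∧
      2 ^ ((Nat.log 2 n + Nat.log 2 (complexity (perPoly (Fin n) ℝ≥0 * h)) + k) ^ k) <
        complexity (perPoly (Fin n) ℝ≥0) := by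
  set k' := max k n₀.factorial with hk'
  have hk'1 : 1 ≤ k' := (Nat.succ_le_of_lt n₀.factorial_pos).trans (le_max_right _ _)
  obtain ⟨n, h, hh, hlt⟩ := two_pow_lt_complexity_perPoly_of_not_pcdr hneg k'
  have hfac := hlt.trans_le (complexity_perPoly_le_factorial_succ n)
  refine ⟨n, ?_, h, hh, (Nat.pow_le_pow_right (by norm_num) (qp_mono (le_max_left _ _) hk'1)).trans_lt hlt⟩
  by_contra hlt'
  push Not at hlt'
  have h1 : (n + 1).factorial ≤ n₀.factorial := Nat.factorial_le hlt'
  have h2 : n₀.factorial ≤ k' := le_max_right _ _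
  have h3 : k' < 2 ^ k' := Nat.lt_two_pow_self
  have h4 : 2 ^ k' ≤ 2 ^ ((Nat.log 2 n + Nat.log 2 (complexity (perPoly (Fin n) ℝ≥0 * h)) + k') ^ k') :=
    Nat.pow_le_pow_right (by norm_num)
      ((by omega : k' ≤ Nat.log 2 n + Nat.log 2 (complexity (perPoly (Fin n) ℝ≥0 * h)) + k').trans
        (Nat.le_self_pow (by omega) _))
  omega

/-! ### The same price for the open stubs K1 (`stub_creationDegree`) and K2
(`stub_cheapPositivization`) of line `Sketch` -/

/-- **A kill of K1 exhibits the same object** (test `A = per_n`): a nonzero monotone multiple `g` of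
`per_n` with `2 ^ ((log₂ n + log₂ L⁺(g) + k) ^ k) < L⁺(per_n)`, for every `k ≥ 1`. [folklore] -/
theorem two_pow_lt_complexity_perPoly_of_not_creationDegree
    (hneg : ¬ ∃ k : ℕ, ∀ (n : ℕ) (g : MvPolynomial (Fin n × Fin n) ℝ≥0), g ≠ 0 →
      perPoly (Fin n) ℝ≥0 ∣ g → ∃ A : MvPolynomial (Fin n × Fin n) ℝ≥0, A ≠ 0 ∧
        perPoly (Fin n) ℝ ∣ MvPolynomial.map NNReal.toRealHom A ∧
        A.totalDegree ≤ 2 ^ ((Nat.log 2 n + Nat.log 2 (complexity g) + k) ^ k) ∧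
        complexity A ≤ 2 ^ ((Nat.log 2 n + Nat.log 2 (complexity g) + k) ^ k))
    (k : ℕ) (hk : 1 ≤ k) :
    ∃ n, ∃ g : MvPolynomial (Fin n × Fin n) ℝ≥0, g ≠ 0 ∧ perPoly (Fin n) ℝ≥0 ∣ g ∧
      2 ^ ((Nat.log 2 n + Nat.log 2 (complexity g) + k) ^ k) < complexity (perPoly (Fin n) ℝ≥0) := by
  by_contra hcon
  push Not at hcon
  apply hneg
  refine ⟨k, fun n g hg hdvd => ⟨perPoly (Fin n) ℝ≥0, perPoly_ne_zero _ _,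
    ⟨1, by rw [map_perPoly, mul_one]⟩, ?_, hcon n g hg hdvd⟩⟩
  rw [totalDegree_perPoly_holds, Fintype.card_fin]
  exact (lt_two_pow_qp n _ k hk).le

/-- **A kill of K2 exhibits the same object** (test the positivizer `p = per_n`, which always works:
`per_n · q = A ≥ 0`): a nonzero nonnegative `A ∈ (per_n)ℝ[x]` with
`2 ^ ((log₂ n + log₂ L⁺(A) + log₂ deg A + k) ^ k) < L⁺(per_n)`, for every `k ≥ 1`.  (Such an `A` is,
after complexification, a cheap element of the ideal of the permanent: its exclusion complexity.)
[folklore] -/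
theorem two_pow_lt_complexity_perPoly_of_not_cheapPositivization
    (hneg : ¬ ∃ k : ℕ, ∀ (n : ℕ) (A : MvPolynomial (Fin n × Fin n) ℝ≥0)
      (q : MvPolynomial (Fin n × Fin n) ℝ), A ≠ 0 →
      MvPolynomial.map NNReal.toRealHom A = perPoly (Fin n) ℝ * q → (∃ m, coeff m q < 0) →
      n + 2 ≤ q.totalDegree → ∃ p : MvPolynomial (Fin n × Fin n) ℝ≥0, p ≠ 0 ∧
        (∀ m, 0 ≤ coeff m (MvPolynomial.map NNReal.toRealHom p * q)) ∧
        p.totalDegree ≤ 2 ^ ((Nat.log 2 n + Nat.log 2 (complexity A) + Nat.log 2 A.totalDegree + k) ^ k) ∧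
        complexity p ≤ 2 ^ ((Nat.log 2 n + Nat.log 2 (complexity A) + Nat.log 2 A.totalDegree + k) ^ k))
    (k : ℕ) (hk : 1 ≤ k) :
    ∃ n, ∃ A : MvPolynomial (Fin n × Fin n) ℝ≥0, A ≠ 0 ∧
      perPoly (Fin n) ℝ ∣ MvPolynomial.map NNReal.toRealHom A ∧
      2 ^ ((Nat.log 2 n + Nat.log 2 (complexity A) + Nat.log 2 A.totalDegree + k) ^ k) <
        complexity (perPoly (Fin n) ℝ≥0) := by
  by_contra hcon
  push Not at hcon
  apply hneg
  refine ⟨k, fun n A q hA hAq _ _ => ⟨perPoly (Fin n) ℝ≥0, perPoly_ne_zero _ _, fun m => ?_, ?_,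
    hcon n A hA ⟨q, hAq⟩⟩⟩
  · rw [map_perPoly, ← hAq, coeff_map]
    exact NNReal.coe_nonneg _
  · rw [totalDegree_perPoly_holds, Fintype.card_fin]
    have := lt_two_pow_qp n (Nat.log 2 (complexity A) + Nat.log 2 A.totalDegree) k hk
    rw [← add_assoc] at this
    exact this.le

/-! ### The two `≠ 0` of the crux -/

/-- **Without `h' ≠ 0` the crux is trivial** (`h' = 0`: degree `0`, `L⁺(per_n · 0) = L⁺(0) = 0`).
[folklore] -/
theorem pcdr_without_witness_nonzero :
    ∃ k : ℕ, ∀ (n : ℕ) (h : MvPolynomial (Fin n × Fin n) ℝ≥0), h ≠ 0 →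
      ∃ h' : MvPolynomial (Fin n × Fin n) ℝ≥0,
        h'.totalDegree ≤ 2 ^ ((Nat.log 2 n + Nat.log 2 (complexity (perPoly (Fin n) ℝ≥0 * h)) + k) ^ k) ∧
        complexity (perPoly (Fin n) ℝ≥0 * h') ≤
          2 ^ ((Nat.log 2 n + Nat.log 2 (complexity (perPoly (Fin n) ℝ≥0 * h)) + k) ^ k) :=
  ⟨0, fun n h _ => ⟨0, by simp, by rw [mul_zero, complexity_zero]; exact Nat.zero_le _⟩⟩

/-- **`h ≠ 0` is load-bearing modulo H1.**  With `h ≠ 0` deleted, `h = 0` makes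
`s = L⁺(per_n · 0) = 0`, and the crux then asserts for every `n` a nonzero `h'` with
`L⁺(per_n · h') ≤ 2 ^ ((log₂ n + k) ^ k)` — which contradicts `PerMultiplesHard` at `c = k`.
[folklore] -/
theorem not_perMultiplesHard_of_pcdr_without_nonzero
    (H : ∃ k : ℕ, ∀ (n : ℕ) (h : MvPolynomial (Fin n × Fin n) ℝ≥0),
      ∃ h' : MvPolynomial (Fin n × Fin n) ℝ≥0, h' ≠ 0 ∧
        h'.totalDegree ≤ 2 ^ ((Nat.log 2 n + Nat.log 2 (complexity (perPoly (Fin n) ℝ≥0 * h)) + k) ^ k) ∧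
        complexity (perPoly (Fin n) ℝ≥0 * h') ≤
          2 ^ ((Nat.log 2 n + Nat.log 2 (complexity (perPoly (Fin n) ℝ≥0 * h)) + k) ^ k)) :
    ¬ PerMultiplesHard := by
  intro hPMH
  obtain ⟨k, hk⟩ := H
  obtain ⟨n₀, hn₀⟩ := hPMH k
  obtain ⟨h', hh', -, hle⟩ := hk n₀ 0
  rw [mul_zero, complexity_zero, Nat.log_zero_right, add_zero] at hle
  exact absurd (hn₀ n₀ le_rfl h' hh') (not_lt.mpr hle)

/-! ### The witness may be chosen uniformly in `h` -/

/-- **The crux is a statement about ONE function of `n`.**  Because the bound `B` depends on `h`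
only through `s = L⁺(per_n · h)`, monotonically, and `s` attains a minimum `E_n` (the monotone
exclusion complexity of `per_n`) over `h ≠ 0`, the witness `h'` can be chosen depending on `n` alone:
PCDR `↔ ∃ k ∀ n ∃ h' ≠ 0 ∀ h ≠ 0, deg h' ≤ B(h) ∧ L⁺(per_n · h') ≤ B(h)`.  So PCDR says exactly: the
cheapest nonzero multiple of `per_n` of degree `≤ qp(n, E_n)` costs `≤ qp(n, E_n)`. [folklore] -/
theorem pcdr_iff_uniform_witness :
    PerCofactorDegreeReduction ↔ ∃ k : ℕ, ∀ n : ℕ, ∃ h' : MvPolynomial (Fin n × Fin n) ℝ≥0, h' ≠ 0 ∧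
      ∀ h : MvPolynomial (Fin n × Fin n) ℝ≥0, h ≠ 0 →
        h'.totalDegree ≤ 2 ^ ((Nat.log 2 n +
          Nat.log 2 (complexity (perPoly (Fin n) ℝ≥0 * h)) + k) ^ k) ∧
        complexity (perPoly (Fin n) ℝ≥0 * h') ≤ 2 ^ ((Nat.log 2 n +
          Nat.log 2 (complexity (perPoly (Fin n) ℝ≥0 * h)) + k) ^ k) := by
  classical
  constructor
  · rintro ⟨k, hk⟩
    refine ⟨k, fun n => ?_⟩
    -- a multiplier of minimal monotone cost
    let P : ℕ → Prop := fun s => ∃ h : MvPolynomial (Fin n × Fin n) ℝ≥0, h ≠ 0 ∧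
      complexity (perPoly (Fin n) ℝ≥0 * h) = s
    have hP : ∃ s, P s := ⟨_, 1, one_ne_zero, rfl⟩
    obtain ⟨h₀, hh₀, hs₀⟩ := Nat.find_spec hP
    have hmin : ∀ h : MvPolynomial (Fin n × Fin n) ℝ≥0, h ≠ 0 →
        complexity (perPoly (Fin n) ℝ≥0 * h₀) ≤ complexity (perPoly (Fin n) ℝ≥0 * h) := by
      intro h hh
      rw [hs₀]
      exact Nat.find_min' hP ⟨h, hh, rfl⟩
    obtain ⟨h', hh', hdeg, hcost⟩ := hk n h₀ hh₀
    refine ⟨h', hh', fun h hh => ?_⟩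
    have hB : 2 ^ ((Nat.log 2 n + Nat.log 2 (complexity (perPoly (Fin n) ℝ≥0 * h₀)) + k) ^ k) ≤
        2 ^ ((Nat.log 2 n + Nat.log 2 (complexity (perPoly (Fin n) ℝ≥0 * h)) + k) ^ k) :=
      Nat.pow_le_pow_right (by norm_num) (Nat.pow_le_pow_left
        (by have := Nat.log_mono_right (b := 2) (hmin h hh); omega) k)
    exact ⟨hdeg.trans hB, hcost.trans hB⟩
  · rintro ⟨k, hk⟩
    refine ⟨k, fun n h hh => ?_⟩
    obtain ⟨h', hh', hall⟩ := hk n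
    exact ⟨h', hh', hall h hh⟩

end Summit.ValiantsHypothesis.Theorems.PerCofactorDegreeReductionNegative

end
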